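import Mathlib

/-!
# Route FilamentSkeletonRss · crux `CoreGluing` (stmt-NavierStokesRegularity-15401) — line `Sketch`,
# stub `stub_outgoingEnvelopeBound`

**Outgoing envelope propagation** (first lemma of the idea card `volterra-ends`; the 1-D model of
the `½(1 + r∂ᵣ)` Leray transport with a nonnegative extra damping `a ≥ 0` along a ray or a
filament end; stated verbatim as `OutgoingEnvelopeBound` in the tree sketch
`Cruxes/CoreGluing/Ideator2Sketch.lean`).

If `φ` is differentiable on `[R, ∞)` with `R > 0`, `a, g` are continuous on `[R, ∞)`, `a ≥ 0`
there, and `r φ'(r) + (1 + a(r)) φ(r) = g(r)` for `r > R`, then for every `r ≥ R`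

  `|r φ(r)| ≤ |R φ(R)| + ∫_R^r |g|` :

the Type-I envelope `χ := r φ` is controlled by its value at the matching radius plus the
integrated source, with no condition at infinity (triangular / Volterra structure).

Proof. `χ' = g − a φ` on `(R, ∞)`, so wherever `χ > 0` one has `χ' ≤ g ≤ |g|`, and wherever
`χ < 0` one has `(−χ)' ≤ −g ≤ |g|`. The fencing lemma
`image_le_of_deriv_right_lt_deriv_boundary` with the perturbed boundary
`B_δ(x) = |R φ(R)| + ∫_R^x |g| + δ (1 + (x − R))`, `δ > 0` (no contact at `x = R` because
`B_δ(R) > |χ(R)|`; at a contact point `x > R` the touching function is positive), gives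
`±χ ≤ B_δ` on `[R, r]`, and `δ → 0` concludes. To use the fundamental theorem of calculus on all
of `ℝ` the integrand `|g|` is replaced by its continuous extension `s ↦ |g (max R s)|`, which
agrees with `|g|` on `[R, r]`. Mathlib only.
-/

set_option linter.dupNamespace false

namespace Summit.NavierStokesRegularity.NavierStokesRegularity.Theorems

open Set Filter MeasureTheory Topology

/-- One-sided fencing step. Let `χ` be continuous on `[R, r]` with right derivative `χ' x`
within `[x, ∞)` at every `x ∈ [R, r)`, let `B` be differentiable on `ℝ` with derivative `G`,
nonnegative on `[R, ∞)`, with `χ R ≤ B R`, and assume `χ' x ≤ G x` at every `x ∈ (R, r)` where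
`χ x > 0`. Then `χ r ≤ B r`. (Apply `image_le_of_deriv_right_lt_deriv_boundary` to the strictly
larger boundary `B + δ (1 + (· − R))` and let `δ → 0`.) -/
private theorem outgoingEnvelope_fence {R r : ℝ} {χ χ' B G : ℝ → ℝ} (hRr : R ≤ r)
    (hχ : ContinuousOn χ (Icc R r)) (hχ' : ∀ x ∈ Ico R r, HasDerivWithinAt χ (χ' x) (Ici x) x)
    (hB : ∀ x, HasDerivAt B (G x) x) (hBR : χ R ≤ B R) (hB0 : ∀ x, R ≤ x → 0 ≤ B x)
    (hbound : ∀ x, R < x → x < r → 0 < χ x → χ' x ≤ G x) : χ r ≤ B r := by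
  refine le_of_forall_pos_le_add fun ε hε => ?_
  have h1 : 0 < 1 + (r - R) := by linarith
  obtain ⟨δ, hδ, hδε⟩ : ∃ δ : ℝ, 0 < δ ∧ δ * (1 + (r - R)) = ε :=
    ⟨ε / (1 + (r - R)), div_pos hε h1, div_mul_cancel₀ ε h1.ne'⟩
  have hBδ : ∀ x, HasDerivAt (fun y => B y + δ * (1 + (y - R))) (G x + δ * 1) x := fun x =>
    (hB x).fun_add ((((hasDerivAt_id' x).sub_const R).const_add 1).const_mul δ)
  have key := image_le_of_deriv_right_lt_deriv_boundary hχ hχ' (B := fun y => B y + δ * (1 + (y - R)))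
    ?_ hBδ ?_ (right_mem_Icc.mpr hRr)
  · linarith [key, hδε]
  · simp only [sub_self, add_zero, mul_one]
    linarith
  · intro x hx hcontact
    rcases hx.1.eq_or_lt with rfl | hRx
    · simp only [sub_self, add_zero, mul_one] at hcontact
      linarith
    · have hpos : 0 < χ x := by
        rw [hcontact]
        have := hB0 x hx.1
        have : 0 < 1 + (x - R) := by linarith
        positivity
      linarith [hbound x hRx hx.2 hpos, mul_one δ]

/-- **Registered stub `stub_outgoingEnvelopeBound`** (line `Sketch` of the crux `CoreGluing`,
stmt-NavierStokesRegularity-15401; first lemma of the card `volterra-ends`, Mathlib only).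
If `R > 0`, `φ` is differentiable on `[R, ∞)`, `a` and `g` are continuous on `[R, ∞)`, `a ≥ 0`
there, and `r φ'(r) + (1 + a(r)) φ(r) = g(r)` for all `r > R`, then
`|r φ(r)| ≤ |R φ(R)| + ∫_R^r |g(s)| ds` for every `r ≥ R`: the Type-I envelope `r |φ|` is
bounded by its value at the matching radius plus the integrated source, with no condition at
infinity. -/
theorem stub_outgoingEnvelopeBound : ∀ (R : ℝ) (φ a g : ℝ → ℝ), 0 < R → DifferentiableOn ℝ φ (Set.Ici R) → ContinuousOn a (Set.Ici R) → ContinuousOn g (Set.Ici R) → (∀ r, R ≤ r → 0 ≤ a r) → (∀ r, R < r → r * deriv φ r + (1 + a r) * φ r = g r) → ∀ r, R ≤ r → |r * φ r| ≤ |R * φ R| + ∫ s in R..r, |g s| := by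
  intro R φ a g hR hφ _ha hg ha0 heq r hr
  -- continuous extension of `|g|` from `[R, ∞)` to `ℝ`
  have hGc : Continuous fun s => |g (max R s)| :=
    (hg.comp_continuous (f := fun s => max R s) (continuous_const.max continuous_id)
      fun s => le_max_left R s).abs
  have hGeq : ∀ s, R ≤ s → |g (max R s)| = |g s| := fun s hs => by rw [max_eq_right hs]
  -- the (unperturbed) boundary `B x = |R φ R| + ∫_R^x |g|`
  have hB : ∀ x, HasDerivAt (fun y => |R * φ R| + ∫ s in R..y, |g (max R s)|)
      (|g (max R x)|) x := fun x =>
    ((hGc.integral_hasStrictDerivAt R x).hasDerivAt).const_add _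
  have hB0 : ∀ x, R ≤ x → 0 ≤ |R * φ R| + ∫ s in R..x, |g (max R s)| := fun x hx =>
    add_nonneg (abs_nonneg _) (intervalIntegral.integral_nonneg hx fun s _ => abs_nonneg _)
  have hBR : (|R * φ R| + ∫ s in R..R, |g (max R s)|) = |R * φ R| := by simp
  -- the envelope `χ = r φ`, its continuity and its right derivative
  have hχc : ContinuousOn (fun y => y * φ y) (Icc R r) :=
    (continuousOn_id.mul hφ.continuousOn).mono Icc_subset_Ici_self
  have hχ' : ∀ x ∈ Ico R r, HasDerivWithinAt (fun y => y * φ y)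
      (1 * φ x + x * derivWithin φ (Ici R) x) (Ici x) x := fun x hx =>
    ((hasDerivWithinAt_id x _).fun_mul (hφ x hx.1).hasDerivWithinAt).mono
      (Ici_subset_Ici.mpr hx.1)
  have hχ'eq : ∀ x, R < x → 1 * φ x + x * derivWithin φ (Ici R) x = g x - a x * φ x := by
    intro x hx
    rw [derivWithin_of_mem_nhds (Ici_mem_nhds hx)]
    linarith [heq x hx]
  -- upper fence: `χ ≤ B`
  have hup : r * φ r ≤ |R * φ R| + ∫ s in R..r, |g (max R s)| := by
    refine outgoingEnvelope_fence (χ := fun y => y * φ y) hr hχc hχ' hB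
      (by rw [hBR]; exact le_abs_self _) hB0 ?_
    intro x hRx _ hpos
    rw [hχ'eq x hRx, hGeq x hRx.le]
    have hφx : 0 < φ x := pos_of_mul_pos_right hpos (hR.trans hRx).le
    nlinarith [le_abs_self (g x), mul_nonneg (ha0 x hRx.le) hφx.le]
  -- lower fence: `-χ ≤ B`
  have hlo : -(r * φ r) ≤ |R * φ R| + ∫ s in R..r, |g (max R s)| := by
    refine outgoingEnvelope_fence (χ := fun y => -(y * φ y))
      (χ' := fun x => -(1 * φ x + x * derivWithin φ (Ici R) x)) hr hχc.fun_neg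
      (fun x hx => (hχ' x hx).fun_neg) hB (by rw [hBR]; exact neg_le_abs _) hB0 ?_
    intro x hRx _ hpos
    rw [hχ'eq x hRx, hGeq x hRx.le]
    have hφx : φ x < 0 := by
      have hneg : x * φ x < 0 := by linarith
      exact neg_of_mul_neg_right hneg (hR.trans hRx).le
    nlinarith [neg_le_abs (g x), mul_nonneg (ha0 x hRx.le) (neg_nonneg.mpr hφx.le)]
  -- conclusion: replace the extension by `|g|` on `[R, r]` and combine the two fences
  rw [intervalIntegral.integral_congr (g := fun s => |g (max R s)|) fun s hs => ?_]
  · exact abs_le.mpr ⟨by linarith, hup⟩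
  · rw [uIcc_of_le hr] at hs
    exact (hGeq s hs.1).symm

end Summit.NavierStokesRegularity.NavierStokesRegularity.Theorems
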